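import Literature.AlgebraicGeometry.AbelianSchemes.AbelianSchemeOverRigidityNoetherian
import Literature.AlgebraicGeometry.AbelianSchemes.AbelianSchemeOverHomEqOfGeometricFibres
import Literature.AlgebraicGeometry.AbelianSchemes.RigidifiedLineBundleComapHom
import Literature.AlgebraicGeometry.Morphisms.LocallyNoetherianLocallyConnected
import HarnessLib

/-!
# The EQUALITY LOCUS of two homomorphisms of abelian schemes is open and closed, and represents «`f_T = g_T`»
# ([MumfordFogartyKirwan1994] Ch. 6 §1 Cor. 6.2 / Cor. 6.4 (rigidity of homomorphisms); [Kottwitz1992] §5 p. 390; [Lan2013] Prop. 1.4.3.4)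

Layer `Literature/AlgebraicGeometry/AbelianSchemes`, namespace `Literature.AlgebraicGeometry.AbelianSchemes.AbelianSchemeOver`.
THEOREMS ONLY (no definition, no named fact, no instance, no notation, no `sorry`).  Cell `hodgecm-mathlib` (D-0151),
programme P6 «MOD» (crux hLiu418 = stmt-HodgeConjecture-24832, `--supports`), organ **(U1-a) «HOM EQUALITY LOCUS»** of the
SPREAD-door census `CENSUS-REP-S-SpreadDoor` (LEAD F0P6-plan M-17n): the engine by which the PEL moduli problem is cut out of the
Siegel fine moduli scheme by CLOSED (indeed open-and-closed) conditions — the Rosati condition `λ ∘ ι(ā) = ι(a)^∨ ∘ λ`, the ring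
relations of an `𝒪`-action `ι(a)ι(b) = ι(ab)`, `ι(a) + ι(b) = ι(a+b)`, and the compatibility of a level structure with `ι` are all
equalities of two HOMOMORPHISMS of abelian schemes after base change ([Kottwitz1992] §5, [RapoportSmithlingZhang2020Diagonal] §4.1,
[Lan2013PELCompactifications] §1.4.1; the representability of such conditions is «standard, cf. [Ko]»).

THE MATHEMATICS.  Let `S` be a locally Noetherian scheme, `A, B` abelian schemes over `S` and `f, g : A → B` homomorphisms.  For a
point `x ∈ S` say «`f = g` over `x`» if the base changes of `f` and `g` to every GEOMETRIC point `Spec Ω → S` centred at `x` agree.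
RIGIDITY OF HOMOMORPHISMS ([MumfordFogartyKirwan1994] Ch. 6 §1 Cor. 6.2: over a CONNECTED locally Noetherian base two homomorphisms
which agree on ONE geometric fibre are equal — ★ `hom_eq_of_pullback_map_eq_of_isLocallyNoetherian`, no reducedness) shows that
the locus `E(f, g) := {x | f = g over x}` is a union of connected components of `S`; a locally Noetherian scheme is locally
connected (★ `Morphisms.locallyConnectedSpace_of_isLocallyNoetherian`), so `E(f, g)` is OPEN AND CLOSED.  By the any-base form of
rigidity (★ `hom_eq_of_forall_pullback_map_eq_of_isLocallyNoetherian_base`: homomorphisms agreeing on ALL geometric fibres are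
equal), `E(f, g)` REPRESENTS the sub-functor «`f_T = g_T`» of `Hom(−, S)` on locally Noetherian `S`-schemes (Mumford's test
category, [MumfordFogartyKirwan1994] Def. 7.2): `f ×_S T = g ×_S T ⟺ u(T) ⊆ E(f, g)` for `u : T → S`.

* §1 `pullback_map_eq_iff_of_comp` — agreement after base change along `t ≫ u` ⟺ agreement of the `u`-base-changes after base
  change along `t` (Mathlib `Over.pullbackComp`).
* §2 `pullback_map_opensι_eq_of_fieldPoint` — over a PRECONNECTED open `U ⊆ S`, agreement at ONE field-valued point of `U` gives
  `f|_U = g|_U` (★ rigidity on `A ×_S U`); `forall_pullback_map_eq_of_mem_connectedComponent` — agreement at one field point over `x`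
  gives agreement at every field point over the connected component of `x`.
* §3 **`isClopen_setOf_forall_pullback_map_eq`** — `E(f, g)` is open and closed; `mem_setOf_forall_pullback_map_eq_iff_exists` —
  `x ∈ E(f, g)` iff `f`, `g` agree at SOME field point over `x`.
* §4 **`pullback_map_eq_iff_range_subset`** — for `u : T → S` with `T` locally Noetherian: `f ×_S T = g ×_S T ↔ u(T) ⊆ E(f, g)`;
  **`exists_opens_isClosed_forall_pullback_map_eq_iff`** — THE HEAD: an open `U ⊆ S` with `U` closed, representing «`f_T = g_T`».

HONEST LABEL: HC_CM is proved only modulo the 2 remaining named inputs (hLiu418 24832, h413 24833) until rung 0 closes; count-neutral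
capital (no letter, no socket, no books row).

## References
* [MumfordFogartyKirwan1994] D. Mumford, J. Fogarty, F. Kirwan, *Geometric Invariant Theory*, 3rd ed. (1994), Ch. 6 §1 Cor. 6.2
  (p. 116), Cor. 6.4 (p. 117); Ch. 7 §2 Def. 7.2 (p. 129).
* [Kottwitz1992] R. Kottwitz, *Points on some Shimura varieties over finite fields*, JAMS 5 (1992), §5 (p. 390).
* [Lan2013PELCompactifications] K.-W. Lan, *Arithmetic compactifications of PEL-type Shimura varieties* (2013), §1.4.1, Prop. 1.4.3.4.
* [RapoportSmithlingZhang2020Diagonal] M. Rapoport, B. Smithling, W. Zhang, *Arithmetic diagonal cycles on unitary Shimura varieties*,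
  Compositio 156 (2020), §4.1 (p. 17).
-/

noncomputable section

universe u

open CategoryTheory CategoryTheory.Limits AlgebraicGeometry
open scoped MonObj

namespace Literature.AlgebraicGeometry.AbelianSchemes

namespace AbelianSchemeOver

open Literature.AlgebraicGeometry.Morphisms

variable {S : Scheme.{u}} {A B : AbelianSchemeOver S} (f g : A.X ⟶ B.X)

/-! ### §1 Agreement after base change is transported along composite base changes -/

/-- A natural isomorphism `F ≅ G` transports the equality `F.map a = F.map b` to `G.map a = G.map b`. [folklore] -/
private theorem map_eq_map_iff_of_natIso {C : Type*} [Category C] {D : Type*} [Category D] {F G : C ⥤ D} (e : F ≅ G)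
    {X Y : C} (a b : X ⟶ Y) : F.map a = F.map b ↔ G.map a = G.map b := by
  constructor
  · intro h
    have ha := e.hom.naturality a
    have hb := e.hom.naturality b
    rw [h] at ha
    rw [← cancel_epi (e.hom.app X), ← hb, ha]
  · intro h
    have ha := e.inv.naturality a
    have hb := e.inv.naturality b
    rw [h] at ha
    rw [← cancel_epi (e.inv.app X), ← hb, ha]

/-- **Base change along a composite**: `f` and `g` agree after base change along `t ≫ u` iff their base changes along `u` agree
after base change along `t` (Mathlib `Over.pullbackComp : Over.pullback (t ≫ u) ≅ Over.pullback u ⋙ Over.pullback t`).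
[cite: GortzWedhorn2020, Section (4.7) (pp. 107–108)] -/
theorem pullback_map_eq_iff_of_comp {S' T : Scheme.{u}} (u : S' ⟶ S) (t : T ⟶ S') :
    (Over.pullback t).map ((Over.pullback u).map f) = (Over.pullback t).map ((Over.pullback u).map g) ↔
      (Over.pullback (t ≫ u)).map f = (Over.pullback (t ≫ u)).map g := by
  rw [map_eq_map_iff_of_natIso (Over.pullbackComp t u) f g]
  rfl

/-! ### §2 Rigidity: agreement at one field point spreads over the connected component -/

/-- A field-valued point whose image lies in an open `U ⊆ S` factors through the open subscheme `U`. [folklore] -/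
private theorem exists_lift_of_mem_opens' (U : S.Opens) {K : Type u} [Field K] (s : Spec (.of K) ⟶ S)
    (hs : s.base (IsLocalRing.closedPoint K) ∈ U) : ∃ s' : Spec (.of K) ⟶ (U : Scheme.{u}), s' ≫ U.ι = s := by
  have hr : Set.range s.base ⊆ Set.range U.ι.base := by
    rintro _ ⟨p, rfl⟩
    rw [Scheme.Opens.range_ι, Subsingleton.elim p (IsLocalRing.closedPoint K)]
    exact hs
  exact ⟨IsOpenImmersion.lift U.ι s hr, IsOpenImmersion.lift_fac U.ι s hr⟩

/-- **Rigidity over a preconnected open** ([MumfordFogartyKirwan1994] Ch. 6 §1 Cor. 6.2): if `U ⊆ S` is a preconnected open of the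
locally Noetherian `S` and the homomorphisms `f, g : A → B` agree after base change to ONE field-valued point of `U`, then they agree
after base change to `U` (★ `hom_eq_of_pullback_map_eq_of_isLocallyNoetherian` for `A ×_S U → B ×_S U`).
[cite: MumfordFogartyKirwan1994, Ch. 6 §1 Corollary 6.2 (p. 116)] -/
theorem pullback_map_opensι_eq_of_fieldPoint [IsLocallyNoetherian S] [IsMonHom f] [IsMonHom g] (U : S.Opens)
    [PreconnectedSpace (U : Scheme.{u})] {K : Type u} [Field K] (t : Spec (.of K) ⟶ (U : Scheme.{u}))
    (h : (Over.pullback (t ≫ U.ι)).map f = (Over.pullback (t ≫ U.ι)).map g) :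
    (Over.pullback U.ι).map f = (Over.pullback U.ι).map g := by
  haveI := (B.baseChange U.ι).isProper
  haveI : IsMonHom (baseChangeHom f U.ι) := isMonHom_baseChangeHom f U.ι
  haveI : IsMonHom (baseChangeHom g U.ι) := isMonHom_baseChangeHom g U.ι
  exact (A.baseChange U.ι).hom_eq_of_pullback_map_eq_of_isLocallyNoetherian (G := (B.baseChange U.ι).X)
    (baseChangeHom f U.ι) (baseChangeHom g U.ι) t ((pullback_map_eq_iff_of_comp f g U.ι t).2 h)

/-- **Agreement spreads over the connected component** ([MumfordFogartyKirwan1994] Ch. 6 §1 Cor. 6.2 on the connected component,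
which is OPEN since a locally Noetherian scheme is locally connected — ★ `locallyConnectedSpace_of_isLocallyNoetherian`): if `f, g`
agree after base change to SOME field-valued point `s` centred at `x`, they agree after base change to EVERY field-valued point `t`
centred in the connected component of `x`. [cite: MumfordFogartyKirwan1994, Ch. 6 §1 Corollary 6.2 (p. 116)] -/
theorem forall_pullback_map_eq_of_mem_connectedComponent [IsLocallyNoetherian S] [IsMonHom f] [IsMonHom g] {x y : S}
    (hy : y ∈ connectedComponent x) {K : Type u} [Field K] (s : Spec (.of K) ⟶ S)
    (hs : s.base (IsLocalRing.closedPoint K) = x) (h : (Over.pullback s).map f = (Over.pullback s).map g)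
    {K' : Type u} [Field K'] (t : Spec (.of K') ⟶ S) (ht : t.base (IsLocalRing.closedPoint K') = y) :
    (Over.pullback t).map f = (Over.pullback t).map g := by
  haveI := locallyConnectedSpace_of_isLocallyNoetherian S
  let U : S.Opens := ⟨connectedComponent x, isOpen_connectedComponent⟩
  haveI : PreconnectedSpace (U : Scheme.{u}) :=
    Subtype.preconnectedSpace (isPreconnected_connectedComponent (x := x))
  obtain ⟨s', hs'⟩ := exists_lift_of_mem_opens' U s (by rw [hs]; exact mem_connectedComponent)
  subst hs'
  have hU := pullback_map_opensι_eq_of_fieldPoint f g U s' h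
  obtain ⟨t', ht'⟩ := exists_lift_of_mem_opens' U t (by rw [ht]; exact hy)
  subst ht'
  rw [← pullback_map_eq_iff_of_comp f g U.ι t', hU]

/-! ### §3 The equality locus is open and closed -/

/-- **`x ∈ E(f, g)` iff `f, g` agree at SOME field-valued point centred at `x`** (then at every geometric point over `x`, by §2 with
`y = x`; conversely the canonical geometric point `Spec κ(x)‾ → S` is a witness). [cite: MumfordFogartyKirwan1994, Ch. 6 §1 Corollary 6.2 (p. 116)] -/
theorem mem_setOf_forall_pullback_map_eq_iff_exists [IsLocallyNoetherian S] [IsMonHom f] [IsMonHom g] (x : S) :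
    x ∈ {x : S | ∀ (Ω : Type u) [Field Ω] [IsAlgClosed Ω] (t : Spec (.of Ω) ⟶ S),
        t.base (IsLocalRing.closedPoint Ω) = x → (Over.pullback t).map f = (Over.pullback t).map g} ↔
      ∃ (K : Type u) (_ : Field K) (s : Spec (.of K) ⟶ S),
        s.base (IsLocalRing.closedPoint K) = x ∧ (Over.pullback s).map f = (Over.pullback s).map g := by
  constructor
  · intro hx
    let Ω₀ : Type u := AlgebraicClosure (S.residueField x)
    let s₀ : Spec (.of Ω₀) ⟶ S :=
      Spec.map (CommRingCat.ofHom (algebraMap (S.residueField x) Ω₀)) ≫ S.fromSpecResidueField x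
    have hs₀ : s₀.base (IsLocalRing.closedPoint Ω₀) = x := by
      change (S.fromSpecResidueField x).base _ = x
      exact Scheme.fromSpecResidueField_apply x _
    exact ⟨Ω₀, inferInstance, s₀, hs₀, hx Ω₀ s₀ hs₀⟩
  · rintro ⟨K, _, s, hs, h⟩ Ω _ _ t ht
    exact forall_pullback_map_eq_of_mem_connectedComponent f g mem_connectedComponent s hs h t ht

/-- **THE EQUALITY LOCUS OF TWO HOMOMORPHISMS OF ABELIAN SCHEMES IS OPEN AND CLOSED** (locally Noetherian base): the set `E(f, g)`
of points `x ∈ S` over which `f` and `g` agree on every geometric fibre is a union of connected components (§2), hence open and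
closed. [cite: MumfordFogartyKirwan1994, Ch. 6 §1 Corollary 6.2 (p. 116) and Corollary 6.4 (p. 117)] -/
theorem isClopen_setOf_forall_pullback_map_eq [IsLocallyNoetherian S] [IsMonHom f] [IsMonHom g] :
    IsClopen {x : S | ∀ (Ω : Type u) [Field Ω] [IsAlgClosed Ω] (t : Spec (.of Ω) ⟶ S),
      t.base (IsLocalRing.closedPoint Ω) = x → (Over.pullback t).map f = (Over.pullback t).map g} := by
  haveI := locallyConnectedSpace_of_isLocallyNoetherian S
  -- the locus is saturated for the connected components
  have hsat : ∀ x y : S, y ∈ connectedComponent x →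
      x ∈ {x : S | ∀ (Ω : Type u) [Field Ω] [IsAlgClosed Ω] (t : Spec (.of Ω) ⟶ S),
        t.base (IsLocalRing.closedPoint Ω) = x → (Over.pullback t).map f = (Over.pullback t).map g} →
      y ∈ {x : S | ∀ (Ω : Type u) [Field Ω] [IsAlgClosed Ω] (t : Spec (.of Ω) ⟶ S),
        t.base (IsLocalRing.closedPoint Ω) = x → (Over.pullback t).map f = (Over.pullback t).map g} := by
    intro x y hy hx
    obtain ⟨K, _, s, hs, h⟩ := (mem_setOf_forall_pullback_map_eq_iff_exists f g x).1 hx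
    exact fun Ω _ _ t ht => forall_pullback_map_eq_of_mem_connectedComponent f g hy s hs h t ht
  constructor
  · -- closed: the complement is a union of (open) connected components
    rw [← isOpen_compl_iff, isOpen_iff_mem_nhds]
    intro x hx
    exact Filter.mem_of_superset (isOpen_connectedComponent.mem_nhds mem_connectedComponent)
      fun y hy hy' => hx (hsat y x (connectedComponent_eq hy ▸ mem_connectedComponent) hy')
  · -- open: a union of (open) connected components
    rw [isOpen_iff_mem_nhds]
    intro x hx
    exact Filter.mem_of_superset (isOpen_connectedComponent.mem_nhds mem_connectedComponent)
      fun y hy => hsat x y hy hx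

/-! ### §4 The equality locus represents «`f_T = g_T`» on locally Noetherian `S`-schemes -/

/-- **`f ×_S T = g ×_S T ⟺ u(T) ⊆ E(f, g)`** for `u : T → S` with `T` locally Noetherian ([MumfordFogartyKirwan1994] Ch. 6 §1 Cor. 6.2 /
6.4: «⇐» by the any-base rigidity ★ `hom_eq_of_forall_pullback_map_eq_of_isLocallyNoetherian_base` on `A ×_S T → B ×_S T`, whose
geometric fibres are geometric fibres of `f, g` over points of `E(f, g)`; «⇒» through the field point `Spec κ(t₀) → T → S` and §3).
[cite: MumfordFogartyKirwan1994, Ch. 6 §1 Corollary 6.2 (p. 116) and Corollary 6.4 (p. 117)] -/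
theorem pullback_map_eq_iff_range_subset [IsLocallyNoetherian S] [IsMonHom f] [IsMonHom g] {T : Scheme.{u}}
    [IsLocallyNoetherian T] (u : T ⟶ S) :
    (Over.pullback u).map f = (Over.pullback u).map g ↔
      Set.range u.base ⊆ {x : S | ∀ (Ω : Type u) [Field Ω] [IsAlgClosed Ω] (t : Spec (.of Ω) ⟶ S),
        t.base (IsLocalRing.closedPoint Ω) = x → (Over.pullback t).map f = (Over.pullback t).map g} := by
  constructor
  · rintro h _ ⟨t₀, rfl⟩
    refine (mem_setOf_forall_pullback_map_eq_iff_exists f g (u.base t₀)).2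
      ⟨T.residueField t₀, inferInstance, T.fromSpecResidueField t₀ ≫ u, ?_, ?_⟩
    · change u ((T.fromSpecResidueField t₀) (IsLocalRing.closedPoint _)) = u t₀
      rw [Scheme.fromSpecResidueField_apply]
    · rw [← pullback_map_eq_iff_of_comp f g u (T.fromSpecResidueField t₀), h]
  · intro h
    haveI : IsMonHom (baseChangeHom f u) := isMonHom_baseChangeHom f u
    haveI : IsMonHom (baseChangeHom g u) := isMonHom_baseChangeHom g u
    refine hom_eq_of_forall_pullback_map_eq_of_isLocallyNoetherian_base (A := A.baseChange u) (B := B.baseChange u)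
      (baseChangeHom f u) (baseChangeHom g u) fun Ω _ _ t' => ?_
    exact (pullback_map_eq_iff_of_comp f g u t').2 (h ⟨t' (IsLocalRing.closedPoint Ω), rfl⟩ Ω (t' ≫ u) rfl)

/-- **THE HEAD — the equality locus as an open-and-closed subscheme representing «`f_T = g_T`»** ([MumfordFogartyKirwan1994] Ch. 6 §1
Cor. 6.2 / 6.4; the representability of the closed PEL conditions, [Kottwitz1992] §5 p. 390 «standard»): for homomorphisms
`f, g : A → B` of abelian schemes over a locally Noetherian `S` there is an OPEN `U ⊆ S` whose underlying set is CLOSED such that, for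
every locally Noetherian `T` and `u : T → S`, `f ×_S T = g ×_S T` iff `u(T) ⊆ U` — i.e. iff `u` factors through the open-and-closed
subscheme `U ↪ S`. [cite: MumfordFogartyKirwan1994, Ch. 6 §1 Corollary 6.2 (p. 116) and Corollary 6.4 (p. 117)] [cite: Kottwitz1992, §5 (p. 390)] -/
theorem exists_opens_isClosed_forall_pullback_map_eq_iff [IsLocallyNoetherian S] [IsMonHom f] [IsMonHom g] :
    ∃ U : S.Opens, IsClosed (U : Set S) ∧ ∀ ⦃T : Scheme.{u}⦄ [IsLocallyNoetherian T] (u : T ⟶ S),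
      (Over.pullback u).map f = (Over.pullback u).map g ↔ Set.range u.base ⊆ (U : Set S) :=
  ⟨⟨_, (isClopen_setOf_forall_pullback_map_eq f g).isOpen⟩, (isClopen_setOf_forall_pullback_map_eq f g).isClosed,
    fun _ _ u => pullback_map_eq_iff_range_subset f g u⟩

/-- **Factorisation form**: `f ×_S T = g ×_S T` iff `u : T → S` factors through the inclusion `U ↪ S` of the equality locus (an open
immersion with closed image). [cite: MumfordFogartyKirwan1994, Ch. 6 §1 Corollary 6.2 (p. 116) and Corollary 6.4 (p. 117)] -/
theorem exists_opens_isClosed_forall_pullback_map_eq_iff_exists_comp [IsLocallyNoetherian S] [IsMonHom f] [IsMonHom g] :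
    ∃ U : S.Opens, IsClosed (U : Set S) ∧ ∀ ⦃T : Scheme.{u}⦄ [IsLocallyNoetherian T] (u : T ⟶ S),
      (Over.pullback u).map f = (Over.pullback u).map g ↔ ∃ u' : T ⟶ (U : Scheme.{u}), u' ≫ U.ι = u := by
  obtain ⟨U, hU, hrep⟩ := exists_opens_isClosed_forall_pullback_map_eq_iff f g
  refine ⟨U, hU, fun T _ u => (hrep u).trans ⟨fun h => ?_, ?_⟩⟩
  · have hr : Set.range u.base ⊆ Set.range U.ι.base := by rwa [Scheme.Opens.range_ι]
    exact ⟨IsOpenImmersion.lift U.ι u hr, IsOpenImmersion.lift_fac U.ι u hr⟩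
  · rintro ⟨u', rfl⟩ _ ⟨t, rfl⟩
    have ht : U.ι (u' t) ∈ Set.range U.ι := ⟨u' t, rfl⟩
    rw [Scheme.Opens.range_ι] at ht
    exact ht

/-- **Over a connected base the locus is all or nothing** (the printed rigidity itself, recorded in the locus currency): if `f, g`
agree at one field point then `f = g`. [cite: MumfordFogartyKirwan1994, Ch. 6 §1 Corollary 6.2 (p. 116)] -/
theorem eq_of_pullback_map_eq_of_preconnectedSpace [IsLocallyNoetherian S] [PreconnectedSpace S] [IsMonHom f] [IsMonHom g]
    {K : Type u} [Field K] (t : Spec (.of K) ⟶ S) (h : (Over.pullback t).map f = (Over.pullback t).map g) : f = g := by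
  haveI := B.isProper
  exact A.hom_eq_of_pullback_map_eq_of_isLocallyNoetherian (G := B.X) f g t h

end AbelianSchemeOver

end Literature.AlgebraicGeometry.AbelianSchemes

end
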